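import Literature.Analysis.FluidPDE.CompressibleEulerAprioriBounds
import HarnessLib

/-!
# `H^m` energy bounds with constants uniform in the solution, and the `C¹` size they control
# (the quantitative half of the life-span bound for compressible Euler on `(UnitAddTorus (Fin 3))`)

Analysis/FluidPDE proof file (theorems only; no definitions, no named facts), sequel of
`CompressibleEulerAprioriBounds.lean`. Majda 1984, Ch. 2, Thm 2.1 states that the classical
solution of a symmetric hyperbolic system exists on a time interval `[0, T]` with "`T` depending on
`‖u₀‖_s` and `G₁`" only; the proof is the a-priori estimate (2.38) with constants depending only
on the `C¹` size of the solution and on the compact part of state space it ranges in, Grönwall,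
and a continuity argument. `CompressibleEulerAprioriBounds.levelEnergy_step` proves the estimate
with constants quantified AFTER the solution; this file re-proves it with the quantifiers in the
uniform order (`∀ K M Cprev m, ∃ constants, ∀ solutions`) and chains the levels `1, 2, 3`:

* `levelEnergy_step_uniform` — the induction step (2.38) with uniform constants and the explicit
  Grönwall bound `E_m(t) ≤ (c₁ E_m(0) e^{K t} + (ε/K)(e^{K t} − 1))/c₀`;
* `levelEnergy_three_uniform` — the level-`3` energy of every primitive solution on `[0, T)`,
  `T ≤ 1`, with state in `K`, `C¹` size `≤ M` and `E₃(0) ≤ E₀` is `≤ Φ e^{κ t} + β (e^{κt} − 1)`-type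
  bounded with constants depending on `(K, M, E₀)` only, in the form `E₃(t) ≤ A E₃(0) + ω(t)` with
  `ω(t) → 0` as `t → 0` uniformly;
* `C1_le_of_levelEnergy_three` — the Sobolev read-out: `‖u‖, |∂ᵢρ|, ‖∂ᵢu‖, |∂ᵢϑ| ≤ 3√(K_S E₃)`.

## References

* A. Majda, *Compressible Fluid Flow and Systems of Conservation Laws in Several Space
  Variables*, Springer 1984, Ch. 2 §2.1, Thm 2.1 (dependence of `T`), Thm 2.2 and (2.38). [Majda1984]
* T. Kato, Arch. Rational Mech. Anal. 58 (1975) 181–205, Thm II (life span bounded below in terms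
  of `‖u₀‖_s`). [Kato1975]
-/

noncomputable section

open Set Function MeasureTheory Filter
open scoped ContDiff Topology

namespace Literature.Analysis.FluidPDE

namespace CompressibleEuler

open Literature.Analysis.FunctionSpaces Literature.Analysis.FunctionSpaces.Torus
open Literature.Analysis.FunctionSpaces.Torus.DiffMonomial

variable {ζ f : ℝ → ℝ}

/-! ### The uniform induction step -/

/-- **The induction step of the `H^m` estimate with prescribed weight bounds** (Majda 1984,
proof of Thm 2.2, eq. (2.38)): as `levelEnergy_step_uniform` below, but with the two-sided
bounds `c₀ ≤ A, ρ, C ≤ c₁` of the symmetriser weights on `K` GIVEN (they depend on `K` only,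
`exists_weights_bounds`), so that the ratio `c₁/c₀` in front of `E_m(0)` is known before the
`C¹` bound `M` is chosen. [cite: Majda1984, Ch. 2 §2.1 Thm 2.1, Thm 2.2 (2.38)] -/
theorem levelEnergy_step_of_weights (hζ : ContDiff ℝ ∞ ζ) {K : Set (ℝ × ℝ)} (hK : IsCompact K)
    (hKhyp : K ⊆ {z : ℝ × ℝ | 0 < z.1 ∧ 0 < z.2 ∧ 0 < deriv (fun s => s * ζ s) z.1})
    {c₀ c₁ : ℝ} (hc₀ : 0 < c₀) (hc₀₁ : c₀ ≤ c₁)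
    (hwK : ∀ z ∈ K, (c₀ ≤ Acoef ζ z.1 z.2 ∧ Acoef ζ z.1 z.2 ≤ c₁) ∧ (c₀ ≤ z.1 ∧ z.1 ≤ c₁) ∧
      (c₀ ≤ Ccoef z.1 z.2 ∧ Ccoef z.1 z.2 ≤ c₁))
    (M Cprev : ℝ) {m : ℕ} (hm : 2 ≤ m) :
    ∃ Kc εc : ℝ, 0 < Kc ∧ 0 ≤ εc ∧
      ∀ {T : ℝ}, 0 < T → ∀ {ρ ϑ : ℝ → (UnitAddTorus (Fin 3)) → ℝ} {u : ℝ → (UnitAddTorus (Fin 3)) → (EuclideanSpace ℝ (Fin 3))},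
        IsPrimitiveEulerSolutionOn (EulerEOS.monatomicExcess ζ f) (Ico 0 T) ρ u ϑ →
        (∀ t ∈ Ico 0 T, ∀ x, (ρ t x, ϑ t x) ∈ K) →
        (∀ t ∈ Ico 0 T, ∀ x, ‖u t x‖ ≤ M ∧ ∀ i, |partialDeriv i (ρ t) x| ≤ M ∧
          ‖partialDeriv i (u t) x‖ ≤ M ∧ |partialDeriv i (ϑ t) x| ≤ M) →
        (∀ t ∈ Ico 0 T, levelEnergy ρ u ϑ (m - 1) t ≤ Cprev) →
        ∀ t₀ ∈ Ico 0 T, levelEnergy ρ u ϑ m t₀ ≤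
          (c₁ * levelEnergy ρ u ϑ m 0 * Real.exp (Kc * t₀) + εc / Kc * (Real.exp (Kc * t₀) - 1)) / c₀ := by
  have hKq : K ⊆ quadrant := fun z hz => ⟨(hKhyp hz).1, (hKhyp hz).2.1⟩
  -- (1) the weights
  have hc₁ : 0 < c₁ := hc₀.trans_le hc₀₁
  -- (2) Sobolev
  obtain ⟨KS, hKS, hSob⟩ := exists_sobolev_const
  -- (3) the static bound `Λ`
  have hζ' : ContDiff ℝ ∞ (deriv ζ) := (contDiff_infty_iff_deriv.1 hζ).2
  have cA : ContinuousOn (uncurry (Acoef ζ)) K := (contDiffOn_Acoef hζ).continuousOn.mono hKq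
  have cAR : ContinuousOn (uncurry (dR (Acoef ζ))) K :=
    (contDiffOn_dR (contDiffOn_Acoef hζ) isOpen_quadrant).continuousOn.mono hKq
  have cAT : ContinuousOn (uncurry (dT (Acoef ζ))) K :=
    (contDiffOn_dT (contDiffOn_Acoef hζ) isOpen_quadrant).continuousOn.mono hKq
  have cC : ContinuousOn (uncurry Ccoef) K := contDiffOn_Ccoef.continuousOn.mono hKq
  have cCR : ContinuousOn (uncurry (dR Ccoef)) K :=
    (contDiffOn_dR contDiffOn_Ccoef isOpen_quadrant).continuousOn.mono hKq
  have cCT : ContinuousOn (uncurry (dT Ccoef)) K :=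
    (contDiffOn_dT contDiffOn_Ccoef isOpen_quadrant).continuousOn.mono hKq
  have cZ : ContinuousOn (fun z : ℝ × ℝ => ζ z.1) K := (hζ.continuous.comp continuous_fst).continuousOn
  have cZ' : ContinuousOn (fun z : ℝ × ℝ => deriv ζ z.1) K := (hζ'.continuous.comp continuous_fst).continuousOn
  have cD : ContinuousOn (uncurry (Dcoef ζ)) K := (contDiffOn_Dcoef hζ).continuousOn.mono hKq
  obtain ⟨B1, hB1, b1⟩ := exists_abs_le_of_continuousOn hK continuous_fst.continuousOn
  obtain ⟨B2, hB2, b2⟩ := exists_abs_le_of_continuousOn hK continuous_snd.continuousOn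
  obtain ⟨B3, hB3, b3⟩ := exists_abs_le_of_continuousOn hK cA
  obtain ⟨B4, hB4, b4⟩ := exists_abs_le_of_continuousOn hK cAR
  obtain ⟨B5, hB5, b5⟩ := exists_abs_le_of_continuousOn hK cAT
  obtain ⟨B6, hB6, b6⟩ := exists_abs_le_of_continuousOn hK cC
  obtain ⟨B7, hB7, b7⟩ := exists_abs_le_of_continuousOn hK cCR
  obtain ⟨B8, hB8, b8⟩ := exists_abs_le_of_continuousOn hK cCT
  obtain ⟨B9, hB9, b9⟩ := exists_abs_le_of_continuousOn hK cZ
  obtain ⟨B10, hB10, b10⟩ := exists_abs_le_of_continuousOn hK cZ'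
  obtain ⟨B11, hB11, b11⟩ := exists_abs_le_of_continuousOn hK cD
  obtain ⟨Λ, hΛdef⟩ : ∃ Λ : ℝ, Λ = B1 + B2 + B3 + B4 + B5 + B6 + B7 + B8 + B9 + B10 + B11 + |M| := ⟨_, rfl⟩
  have hMΛ : M ≤ Λ := by have := le_abs_self M; rw [hΛdef]; linarith
  have hΛ1 : 1 ≤ Λ := by rw [hΛdef]; linarith [abs_nonneg M]
  have hΛ0 : 0 ≤ Λ := zero_le_one.trans hΛ1
  obtain ⟨L, hLdef⟩ : ∃ L : ℝ, L = 12 * Λ ^ 3 := ⟨_, rfl⟩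
  have hL0 : 0 ≤ L := by rw [hLdef]; exact mul_nonneg (by norm_num) (pow_nonneg hΛ0 3)
  -- (4) sup bounds of low order: `S`
  obtain ⟨S, hSdef⟩ : ∃ S : ℝ, S = Λ + Real.sqrt (KS * Cprev) := ⟨_, rfl⟩
  have hS1 : 1 ≤ S := by rw [hSdef]; linarith [Real.sqrt_nonneg (KS * Cprev)]
  have hS0 : 0 ≤ S := zero_le_one.trans hS1
  -- (5) the coefficient constants `Γ`, uniformly over all words of length `≤ m`
  have hΓall : ∀ σ : (Σ n : Fin (m + 1), (Fin n → Fin 3)),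
      ∃ Γ : ℝ, 0 ≤ Γ ∧ ∀ (φ : PIdx → (UnitAddTorus (Fin 3)) → ℝ), (∀ k, IsSmooth (φ k)) →
        (∀ x, (φ PIdx.rho x, φ PIdx.theta x) ∈ K) →
        ∀ (S Ξ B X : ℝ), 1 ≤ S → 0 ≤ Ξ → 0 ≤ B → 0 ≤ X →
          (∀ (k : PIdx) (v : List (Fin 3)), v.length ≤ max 1 (m - 3) → ∀ x, |iterPartialDeriv v (φ k) x| ≤ S) →
          (∀ (k : PIdx) (v : List (Fin 3)), v.length ≤ m - 2 → ∀ x, |iterPartialDeriv v (φ k) x| ≤ Ξ) →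
          (∀ (k : PIdx) (v : List (Fin 3)), v.length ≤ m - 1 →
            Real.sqrt (∫ x, iterPartialDeriv v (φ k) x ^ 2) ≤ B) →
          (∀ (k : PIdx) (v : List (Fin 3)), v.length ≤ m →
            Real.sqrt (∫ x, iterPartialDeriv v (φ k) x ^ 2) ≤ X) →
          Real.sqrt (∫ x, (((FF (List.ofFn σ.2)).map fun T => T.eval φ PIdx.rho PIdx.theta x).sum) ^ 2) ≤
              Γ * S ^ (m + 1) * (3 * X + B * Ξ + 1) ∧
            (∀ k, Real.sqrt (∫ x, (((GG ζ k (List.ofFn σ.2)).map fun T => T.eval φ PIdx.rho PIdx.theta x).sum) ^ 2) ≤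
              Γ * S ^ (m + 1) * (3 * X + B * Ξ + 1)) ∧
            Real.sqrt (∫ x, (((HH ζ (List.ofFn σ.2)).map fun T => T.eval φ PIdx.rho PIdx.theta x).sum) ^ 2) ≤
              Γ * S ^ (m + 1) * (3 * X + B * Ξ + 1) := by
    rintro ⟨n, w⟩
    have hn : (List.ofFn w).length ≤ m := by simp; omega
    obtain ⟨Γ₁, hΓ₁0, hΓ₁⟩ := exists_list_l2_bound hK hKq (FF (List.ofFn w)) fun T hT => (mem_FF _ hT).2.2.2.2.2
    have hG : ∀ k, ∃ Γ : ℝ, 0 ≤ Γ ∧ _ := fun k =>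
      exists_list_l2_bound hK hKq (GG ζ k (List.ofFn w)) fun T hT => (mem_GG hζ k _ hT).2.2.2.2.2
    choose Γ₂ hΓ₂0 hΓ₂ using hG
    obtain ⟨Γ₃, hΓ₃0, hΓ₃⟩ := exists_list_l2_bound hK hKq (HH ζ (List.ofFn w)) fun T hT => (mem_HH hζ _ hT).2.2.2.2.2
    refine ⟨Γ₁ + (∑ k, Γ₂ k) + Γ₃, add_nonneg (add_nonneg hΓ₁0 (Finset.sum_nonneg fun k _ => hΓ₂0 k)) hΓ₃0,
      fun φ hφ hφK S Ξ B X hS1 hΞ0 hB0 hX0 hS hΞ hB hX => ?_⟩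
    have shapeF : ∀ T ∈ FF (List.ofFn w), T.Proper ∧ 2 ≤ T.width ∧ T.width ≤ (List.ofFn w).length + 1 ∧
        T.order = (List.ofFn w).length + 1 ∧ T.maxOrder ≤ (List.ofFn w).length := fun T hT =>
      let h := mem_FF (List.ofFn w) hT; ⟨h.1, h.2.1, h.2.2.1, h.2.2.2.1, h.2.2.2.2.1⟩
    have e1 := hΓ₁ φ hφ hφK _ m shapeF hn S Ξ B X hS1 hΞ0 hB0 hX0 hS hΞ hB hX
    have e3 := hΓ₃ φ hφ hφK _ m (fun T hT => let h := mem_HH hζ (List.ofFn w) hT;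
      ⟨h.1, h.2.1, h.2.2.1, h.2.2.2.1, h.2.2.2.2.1⟩) hn S Ξ B X hS1 hΞ0 hB0 hX0 hS hΞ hB hX
    have e2 : ∀ k, _ := fun k => hΓ₂ k φ hφ hφK _ m (fun T hT => let h := mem_GG hζ k (List.ofFn w) hT;
      ⟨h.1, h.2.1, h.2.2.1, h.2.2.2.1, h.2.2.2.2.1⟩) hn S Ξ B X hS1 hΞ0 hB0 hX0 hS hΞ hB hX
    have hsum2 : ∀ k, Γ₂ k ≤ ∑ k, Γ₂ k := fun k =>
      Finset.single_le_sum (f := Γ₂) (fun k _ => hΓ₂0 k) (Finset.mem_univ k)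
    refine ⟨e1.trans ?_, fun k => (e2 k).trans ?_, e3.trans ?_⟩
    · have : Γ₁ ≤ Γ₁ + (∑ k, Γ₂ k) + Γ₃ := by linarith [Finset.sum_nonneg fun k (_ : k ∈ Finset.univ) => hΓ₂0 k]
      exact mul_le_mul_of_nonneg_right (mul_le_mul_of_nonneg_right this (pow_nonneg (zero_le_one.trans hS1) _))
        (by positivity)
    · have : Γ₂ k ≤ Γ₁ + (∑ k, Γ₂ k) + Γ₃ := by linarith [hsum2 k]
      exact mul_le_mul_of_nonneg_right (mul_le_mul_of_nonneg_right this (pow_nonneg (zero_le_one.trans hS1) _))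
        (by positivity)
    · have : Γ₃ ≤ Γ₁ + (∑ k, Γ₂ k) + Γ₃ := by linarith [Finset.sum_nonneg fun k (_ : k ∈ Finset.univ) => hΓ₂0 k]
      exact mul_le_mul_of_nonneg_right (mul_le_mul_of_nonneg_right this (pow_nonneg (zero_le_one.trans hS1) _))
        (by positivity)
  choose Γσ hΓσ0 hΓσ using hΓall
  let Γ : ℝ := ∑ σ, Γσ σ
  have hΓ0 : 0 ≤ Γ := Finset.sum_nonneg fun σ _ => hΓσ0 σ
  have hΓσle : ∀ σ, Γσ σ ≤ Γ := fun σ => Finset.single_le_sum (f := Γσ) (fun σ _ => hΓσ0 σ) (Finset.mem_univ σ)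
  clear_value Γ
  -- (6) the constants of the differential inequality
  have hW0 : 0 ≤ levelCount m := levelCount_nonneg m
  have hW1 : 1 ≤ levelCount m := one_le_levelCount m
  obtain ⟨Bc, hBcdef⟩ : ∃ Bc : ℝ, Bc = Real.sqrt Cprev := ⟨_, rfl⟩
  have hBc0 : 0 ≤ Bc := by rw [hBcdef]; exact Real.sqrt_nonneg _
  obtain ⟨κ, hκ⟩ : ∃ κ : ℝ, κ = 10 * L * Γ * S ^ (m + 1) := ⟨_, rfl⟩
  have hκ0 : 0 ≤ κ := by
    rw [hκ]; exact mul_nonneg (mul_nonneg (mul_nonneg (by norm_num) hL0) hΓ0) (pow_nonneg hS0 _)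
  have h4B : (0 : ℝ) ≤ 4 + Bc * Real.sqrt KS := add_nonneg (by norm_num) (mul_nonneg hBc0 (Real.sqrt_nonneg _))
  have hL18 : 0 ≤ L + 18 * L ^ 2 := add_nonneg hL0 (mul_nonneg (by norm_num) (sq_nonneg L))
  obtain ⟨K₁, hK₁⟩ : ∃ K₁ : ℝ, K₁ = (L + 18 * L ^ 2) + κ * (4 + Bc * Real.sqrt KS) := ⟨_, rfl⟩
  have hK₁0 : 0 ≤ K₁ := by rw [hK₁]; exact add_nonneg hL18 (mul_nonneg hκ0 h4B)
  obtain ⟨Kc, hKcdef⟩ : ∃ Kc : ℝ, Kc = K₁ * (levelCount m) / c₀ + 1 := ⟨_, rfl⟩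
  have hKc : 0 < Kc := by
    rw [hKcdef]; exact add_pos_of_nonneg_of_pos (div_nonneg (mul_nonneg hK₁0 hW0) hc₀.le) one_pos
  obtain ⟨εc, hεc⟩ : ∃ εc : ℝ, εc = κ * (levelCount m) := ⟨_, rfl⟩
  have hεc0 : 0 ≤ εc := by rw [hεc]; exact mul_nonneg hκ0 hW0
  refine ⟨Kc, εc, hKc, hεc0, ?_⟩
  intro T hT ρ ϑ u h hstate hC1 hprev t₀ ht₀
  have hKb : ∀ t ∈ Ico 0 T, ∀ y, |ρ t y| ≤ Λ ∧ |ϑ t y| ≤ Λ ∧ |Acoef ζ (ρ t y) (ϑ t y)| ≤ Λ ∧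
      |dR (Acoef ζ) (ρ t y) (ϑ t y)| ≤ Λ ∧ |dT (Acoef ζ) (ρ t y) (ϑ t y)| ≤ Λ ∧
      |Ccoef (ρ t y) (ϑ t y)| ≤ Λ ∧ |dR Ccoef (ρ t y) (ϑ t y)| ≤ Λ ∧ |dT Ccoef (ρ t y) (ϑ t y)| ≤ Λ ∧
      |ζ (ρ t y)| ≤ Λ ∧ |deriv ζ (ρ t y)| ≤ Λ ∧ |Dcoef ζ (ρ t y) (ϑ t y)| ≤ Λ := by
    intro t ht y
    have hz := hstate t ht y
    have l1 := b1 _ hz; have l2 := b2 _ hz; have l3 := b3 _ hz; have l4 := b4 _ hz; have l5 := b5 _ hz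
    have l6 := b6 _ hz; have l7 := b7 _ hz; have l8 := b8 _ hz; have l9 := b9 _ hz; have l10 := b10 _ hz
    have l11 := b11 _ hz
    simp only [uncurry] at l1 l2 l3 l4 l5 l6 l7 l8 l9 l10 l11
    have hpos : ∀ {x B : ℝ}, |x| ≤ B → B ≤ Λ → |x| ≤ Λ := fun h1 h2 => h1.trans h2
    have hall : 0 ≤ B1 ∧ 0 ≤ B2 ∧ 0 ≤ B3 ∧ 0 ≤ B4 ∧ 0 ≤ B5 ∧ 0 ≤ B6 ∧ 0 ≤ B7 ∧ 0 ≤ B8 ∧ 0 ≤ B9 ∧ 0 ≤ B10 ∧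
        0 ≤ B11 ∧ 0 ≤ |M| := ⟨by linarith, by linarith, by linarith, by linarith, by linarith, by linarith,
          by linarith, by linarith, by linarith, by linarith, by linarith, abs_nonneg M⟩
    refine ⟨hpos l1 ?_, hpos l2 ?_, hpos l3 ?_, hpos l4 ?_, hpos l5 ?_, hpos l6 ?_, hpos l7 ?_, hpos l8 ?_,
      hpos l9 ?_, hpos l10 ?_, hpos l11 ?_⟩ <;> (rw [hΛdef]; linarith)
  have hMb : ∀ t ∈ Ico 0 T, ∀ y, ‖u t y‖ ≤ Λ ∧ ∀ i, |partialDeriv i (ρ t) y| ≤ Λ ∧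
      ‖partialDeriv i (u t) y‖ ≤ Λ ∧ |partialDeriv i (ϑ t) y| ≤ Λ := fun t ht y =>
    ⟨(hC1 t ht y).1.trans hMΛ, fun i => ⟨((hC1 t ht y).2 i).1.trans hMΛ, ((hC1 t ht y).2 i).2.1.trans hMΛ,
      ((hC1 t ht y).2 i).2.2.trans hMΛ⟩⟩
  have hφs : ∀ t ∈ Ico 0 T, ∀ k, IsSmooth (primFields ρ u ϑ t k) := fun t ht => isSmooth_primFields h ht
  have hlow : ∀ t ∈ Ico 0 T, ∀ (k : PIdx) (v : List (Fin 3)), v.length ≤ 1 → ∀ x,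
      |iterPartialDeriv v (primFields ρ u ϑ t k) x| ≤ Λ := by
    intro t ht k v hv x
    have hu1 : IsContDiff 1 (u t) := (h.smooth_velocity.isSmooth_slice ht).isContDiff (by simp)
    rcases list_length_le_one hv with rfl | ⟨i, rfl⟩
    · rcases k with _ | _ | k
      · exact (hKb t ht x).1
      · exact (hKb t ht x).2.1
      · simp only [iterPartialDeriv_nil, primFields]
        exact (abs_apply_le_norm _ _).trans (hMb t ht x).1
    · rcases k with _ | _ | k
      · simpa using ((hMb t ht x).2 i).1
      · simpa using ((hMb t ht x).2 i).2.2
      · simp only [iterPartialDeriv_cons, iterPartialDeriv_nil, primFields]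
        rw [partialDeriv_apply_coord hu1]
        exact (abs_apply_le_norm _ _).trans ((hMb t ht x).2 i).2.1
  have hSup : ∀ t ∈ Ico 0 T, ∀ (k : PIdx) (v : List (Fin 3)), v.length ≤ max 1 (m - 3) → ∀ x,
      |iterPartialDeriv v (primFields ρ u ϑ t k) x| ≤ S := by
    intro t ht k v hv x
    by_cases h1 : v.length ≤ 1
    · exact (hlow t ht k v h1 x).trans (by rw [hSdef]; linarith [Real.sqrt_nonneg (KS * Cprev)])
    · have hv' : v.length + 2 ≤ m - 1 := by
        have := le_max_iff.1 hv; omega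
      have h2 := hSob ρ ϑ u t (hφs t ht) k v x
      have h3 : levelEnergy ρ u ϑ (v.length + 2) t ≤ Cprev := (levelEnergy_mono hv' t).trans (hprev t ht)
      have h4 : iterPartialDeriv v (primFields ρ u ϑ t k) x ^ 2 ≤ KS * Cprev :=
        h2.trans (mul_le_mul_of_nonneg_left h3 hKS.le)
      calc |iterPartialDeriv v (primFields ρ u ϑ t k) x| = Real.sqrt (iterPartialDeriv v (primFields ρ u ϑ t k) x ^ 2) :=
            (Real.sqrt_sq_eq_abs _).symm
        _ ≤ Real.sqrt (KS * Cprev) := Real.sqrt_le_sqrt h4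
        _ ≤ S := by rw [hSdef]; linarith
  obtain ⟨δ, hδdef⟩ : ∃ δ : ℝ, δ = c₁ * levelEnergy ρ u ϑ m 0 := ⟨_, rfl⟩
  have hδ0 : 0 ≤ δ := by rw [hδdef]; exact mul_nonneg hc₁.le (levelEnergy_nonneg _ _)
  -- (7) the sub-interval `[0, τ]`
  let τ : ℝ := max t₀ (T / 2)
  have hτ : 0 < τ := lt_max_of_lt_right (half_pos hT)
  have hτT : τ < T := max_lt ht₀.2 (half_lt_self hT)
  have ht₀τ : t₀ ∈ Icc 0 τ := ⟨ht₀.1, le_max_left _ _⟩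
  have hsub : Icc 0 τ ⊆ Ico 0 T := Icc_subset_Ico_right hτT
  have hsol := h.restrict_Icc hτ hτT
  have hSτ : UniqueDiffOn ℝ (Icc 0 τ) := uniqueDiffOn_Icc hτ
  -- the function and its derivative
  let g : ℝ → ℝ := weightedLevelEnergy ζ ρ u ϑ m
  have hgdef : g = weightedLevelEnergy ζ ρ u ϑ m := rfl
  let D : List (Fin 3) → ℝ → ℝ := fun w t => ∫ y, timeDerivWithin (Icc 0 τ)
    (fun s y => Acoef ζ (ρ s y) (ϑ s y) * iterPartialDeriv w (ρ s) y ^ 2 +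
      ρ s y * (∑ k, iterPartialDeriv w (fun y => u s y k) y ^ 2) +
      Ccoef (ρ s y) (ϑ s y) * iterPartialDeriv w (ϑ s) y ^ 2) t y
  let g' : ℝ → ℝ := fun t => ∑ n ∈ Finset.range (m + 1), ∑ w : Fin n → Fin 3, D (List.ofFn w) t
  have hderiv : ∀ t ∈ Icc 0 τ, HasDerivWithinAt g (g' t) (Icc 0 τ) t := fun t ht =>
    HasDerivWithinAt.fun_sum fun n _ => HasDerivWithinAt.fun_sum fun w _ =>
      hasDerivWithinAt_weightedWordEnergy hζ hSτ (convex_Icc 0 τ) hsol (List.ofFn w) ht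
  have hcont : ContinuousOn g (Icc 0 τ) := fun t ht => (hderiv t ht).continuousWithinAt
  have hderiv' : ∀ t ∈ Ico 0 τ, HasDerivWithinAt g (g' t) (Ici t) t := fun t ht =>
    (hderiv t (Ico_subset_Icc_self ht)).mono_of_mem_nhdsWithin
      (mem_of_superset (Icc_mem_nhdsGE ht.2) (Icc_subset_Icc ht.1 le_rfl))
  -- comparison `c₀ E ≤ g ≤ c₁ E` on `[0, τ]`
  have hwS : ∀ t ∈ Icc 0 τ, ∀ y, (c₀ ≤ Acoef ζ (ρ t y) (ϑ t y) ∧ Acoef ζ (ρ t y) (ϑ t y) ≤ c₁) ∧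
      (c₀ ≤ ρ t y ∧ ρ t y ≤ c₁) ∧ (c₀ ≤ Ccoef (ρ t y) (ϑ t y) ∧ Ccoef (ρ t y) (ϑ t y) ≤ c₁) := fun t ht y =>
    hwK _ (hstate t (hsub ht) y)
  have hcmp : ∀ t ∈ Icc 0 τ, c₀ * levelEnergy ρ u ϑ m t ≤ g t ∧ g t ≤ c₁ * levelEnergy ρ u ϑ m t := by
    intro t ht
    simp only [hgdef, weightedLevelEnergy, levelEnergy, Finset.mul_sum]
    exact ⟨Finset.sum_le_sum fun n _ => Finset.sum_le_sum fun w _ =>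
        (weightedWordEnergy_compare hζ hsol hwS (List.ofFn w) ht).1,
      Finset.sum_le_sum fun n _ => Finset.sum_le_sum fun w _ =>
        (weightedWordEnergy_compare hζ hsol hwS (List.ofFn w) ht).2⟩
  have hgnn : ∀ t ∈ Icc 0 τ, 0 ≤ g t := fun t ht =>
    (mul_nonneg hc₀.le (levelEnergy_nonneg _ _)).trans (hcmp t ht).1
  -- (8) the bound on the derivative
  have hbound : ∀ t ∈ Ico 0 τ, ‖g' t‖ ≤ Kc * ‖g t‖ + εc := by
    intro t ht
    have htc : t ∈ Icc 0 τ := Ico_subset_Icc_self ht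
    have htT : t ∈ Ico 0 T := hsub htc
    obtain ⟨E, hEdef⟩ : ∃ E : ℝ, E = levelEnergy ρ u ϑ m t := ⟨_, rfl⟩
    have hE0 : 0 ≤ E := by rw [hEdef]; exact levelEnergy_nonneg _ _
    obtain ⟨X, hXdef⟩ : ∃ X : ℝ, X = Real.sqrt E := ⟨_, rfl⟩
    have hX0 : 0 ≤ X := by rw [hXdef]; exact Real.sqrt_nonneg _
    obtain ⟨Ξ, hΞdef⟩ : ∃ Ξ : ℝ, Ξ = Real.sqrt (KS * E) := ⟨_, rfl⟩
    have hΞ0 : 0 ≤ Ξ := by rw [hΞdef]; exact Real.sqrt_nonneg _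
    have hφst := hφs t htT
    have hφK : ∀ x, (primFields ρ u ϑ t PIdx.rho x, primFields ρ u ϑ t PIdx.theta x) ∈ K := fun x => hstate t htT x
    -- the level-`m` hypotheses at time `t`
    have hXb : ∀ (k : PIdx) (v : List (Fin 3)), v.length ≤ m →
        Real.sqrt (∫ x, iterPartialDeriv v (primFields ρ u ϑ t k) x ^ 2) ≤ X := fun k v hv => by
      rw [hXdef, hEdef]; exact Real.sqrt_le_sqrt (integral_sq_primFields_le hv t k)
    have hBb : ∀ (k : PIdx) (v : List (Fin 3)), v.length ≤ m - 1 →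
        Real.sqrt (∫ x, iterPartialDeriv v (primFields ρ u ϑ t k) x ^ 2) ≤ Bc := fun k v hv => by
      rw [hBcdef]; exact Real.sqrt_le_sqrt ((integral_sq_primFields_le hv t k).trans (hprev t htT))
    have hΞb : ∀ (k : PIdx) (v : List (Fin 3)), v.length ≤ m - 2 → ∀ x,
        |iterPartialDeriv v (primFields ρ u ϑ t k) x| ≤ Ξ := by
      intro k v hv x
      have h2 := hSob ρ ϑ u t hφst k v x
      have h3 : levelEnergy ρ u ϑ (v.length + 2) t ≤ E := by rw [hEdef]; exact levelEnergy_mono (by omega) t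
      calc |iterPartialDeriv v (primFields ρ u ϑ t k) x|
          = Real.sqrt (iterPartialDeriv v (primFields ρ u ϑ t k) x ^ 2) := (Real.sqrt_sq_eq_abs _).symm
        _ ≤ Real.sqrt (KS * E) := Real.sqrt_le_sqrt (h2.trans (mul_le_mul_of_nonneg_left h3 hKS.le))
        _ = Ξ := hΞdef.symm
    -- commutator bounds, per word
    have hXQ : X * (3 * X + Bc * Ξ + 1) ≤ (4 + Bc * Real.sqrt KS) * E + 1 := by
      have hΞ' : Ξ = Real.sqrt KS * X := by rw [hΞdef, hXdef, Real.sqrt_mul hKS.le]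
      have hXX : X * X = E := by rw [hXdef]; exact Real.mul_self_sqrt hE0
      have hX1 : X ≤ E + 1 := by rw [hXdef]; exact sqrt_le_add_one hE0
      have hb0 : 0 ≤ Bc * Real.sqrt KS := mul_nonneg hBc0 (Real.sqrt_nonneg KS)
      calc X * (3 * X + Bc * Ξ + 1) = (3 + Bc * Real.sqrt KS) * (X * X) + X := by rw [hΞ']; ring
        _ = (3 + Bc * Real.sqrt KS) * E + X := by rw [hXX]
        _ ≤ (3 + Bc * Real.sqrt KS) * E + (E + 1) := add_le_add le_rfl hX1
        _ = (4 + Bc * Real.sqrt KS) * E + 1 := by ring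
    have hP0 : 0 ≤ 3 * X + Bc * Ξ + 1 :=
      add_nonneg (add_nonneg (mul_nonneg (by norm_num) hX0) (mul_nonneg hBc0 hΞ0)) zero_le_one
    have hword : ∀ (n : ℕ) (w : Fin n → Fin 3), n ≤ m →
        |D (List.ofFn w) t| ≤ (L + 18 * L ^ 2) * wordEnergy ρ u ϑ (List.ofFn w) t +
          κ * ((4 + Bc * Real.sqrt KS) * E + 1) := by
      intro n w hn
      have hlen : (List.ofFn w).length ≤ m := by simpa using hn
      have key := abs_integral_timeDerivWithin_weighted_le hζ hτ hsol hΛ1 (fun s hs y => hKb s (hsub hs) y)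
        (fun s hs y => hMb s (hsub hs) y) (List.ofFn w) htc
      obtain ⟨hF, hG, hH⟩ := hΓσ ⟨⟨n, Nat.lt_succ_of_le hn⟩, w⟩ (primFields ρ u ϑ t) hφst hφK S Ξ Bc X hS1 hΞ0 hBc0 hX0
        (hSup t htT) hΞb hBb hXb
      simp only at hF hG hH
      obtain ⟨Q, hQdef⟩ : ∃ Q : ℝ, Q = Γ * S ^ (m + 1) * (3 * X + Bc * Ξ + 1) := ⟨_, rfl⟩
      have hΓ' : Γσ ⟨⟨n, Nat.lt_succ_of_le hn⟩, w⟩ * S ^ (m + 1) * (3 * X + Bc * Ξ + 1) ≤ Q := by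
        have := hΓσle ⟨⟨n, Nat.lt_succ_of_le hn⟩, w⟩
        have hq : 0 ≤ S ^ (m + 1) * (3 * X + Bc * Ξ + 1) := mul_nonneg (pow_nonneg hS0 _) hP0
        calc Γσ ⟨⟨n, Nat.lt_succ_of_le hn⟩, w⟩ * S ^ (m + 1) * (3 * X + Bc * Ξ + 1)
            = Γσ ⟨⟨n, Nat.lt_succ_of_le hn⟩, w⟩ * (S ^ (m + 1) * (3 * X + Bc * Ξ + 1)) := mul_assoc _ _ _
          _ ≤ Γ * (S ^ (m + 1) * (3 * X + Bc * Ξ + 1)) := mul_le_mul_of_nonneg_right this hq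
          _ = Γ * S ^ (m + 1) * (3 * X + Bc * Ξ + 1) := (mul_assoc _ _ _).symm
          _ = Q := hQdef.symm
      -- the three norms of `∂^w` fields are `≤ X`
      have nR : Real.sqrt (∫ y, iterPartialDeriv (List.ofFn w) (ρ t) y ^ 2) ≤ X := hXb PIdx.rho _ hlen
      have nΘ : Real.sqrt (∫ y, iterPartialDeriv (List.ofFn w) (ϑ t) y ^ 2) ≤ X := hXb PIdx.theta _ hlen
      have nU : ∀ k, Real.sqrt (∫ y, iterPartialDeriv (List.ofFn w) (fun y => u t y k) y ^ 2) ≤ X := fun k =>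
        hXb (PIdx.vel k) _ hlen
      have hsrc : Real.sqrt (∫ y, iterPartialDeriv (List.ofFn w) (ρ t) y ^ 2) *
            Real.sqrt (∫ y, ((FF (List.ofFn w)).map fun T => T.eval (primFields ρ u ϑ t) PIdx.rho PIdx.theta y).sum ^ 2) +
          (∑ k, Real.sqrt (∫ y, iterPartialDeriv (List.ofFn w) (fun y => u t y k) y ^ 2) *
            Real.sqrt (∫ y, ((GG ζ k (List.ofFn w)).map fun T => T.eval (primFields ρ u ϑ t) PIdx.rho PIdx.theta y).sum ^ 2)) +
          Real.sqrt (∫ y, iterPartialDeriv (List.ofFn w) (ϑ t) y ^ 2) *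
            Real.sqrt (∫ y, ((HH ζ (List.ofFn w)).map fun T => T.eval (primFields ρ u ϑ t) PIdx.rho PIdx.theta y).sum ^ 2)
          ≤ 5 * (X * Q) := by
        have h1 : _ ≤ X * Q := mul_le_mul nR (hF.trans hΓ') (Real.sqrt_nonneg _) hX0
        have h3 : _ ≤ X * Q := mul_le_mul nΘ (hH.trans hΓ') (Real.sqrt_nonneg _) hX0
        have h2 : ∀ k, _ ≤ X * Q := fun k => mul_le_mul (nU k) ((hG k).trans hΓ') (Real.sqrt_nonneg _) hX0
        have h2s : (∑ k, Real.sqrt (∫ y, iterPartialDeriv (List.ofFn w) (fun y => u t y k) y ^ 2) *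
            Real.sqrt (∫ y, ((GG ζ k (List.ofFn w)).map fun T => T.eval (primFields ρ u ϑ t) PIdx.rho PIdx.theta y).sum ^ 2))
            ≤ ∑ _k : Fin 3, X * Q := Finset.sum_le_sum fun k _ => h2 k
        simp only [Finset.sum_const, Finset.card_univ, Fintype.card_fin, nsmul_eq_mul, Nat.cast_ofNat] at h2s
        calc _ ≤ X * Q + 3 * (X * Q) + X * Q := add_le_add (add_le_add h1 h2s) h3
          _ = 5 * (X * Q) := by ring
      have hXQ' : X * Q ≤ Γ * S ^ (m + 1) * ((4 + Bc * Real.sqrt KS) * E + 1) := by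
        rw [hQdef]
        have : X * (Γ * S ^ (m + 1) * (3 * X + Bc * Ξ + 1)) = Γ * S ^ (m + 1) * (X * (3 * X + Bc * Ξ + 1)) := by ring
        rw [this]
        exact mul_le_mul_of_nonneg_left hXQ (mul_nonneg hΓ0 (pow_nonneg hS0 _))
      have key' : |D (List.ofFn w) t| ≤ (L + 18 * L ^ 2) * wordEnergy ρ u ϑ (List.ofFn w) t + 2 * L *
          (Real.sqrt (∫ y, iterPartialDeriv (List.ofFn w) (ρ t) y ^ 2) *
            Real.sqrt (∫ y, ((FF (List.ofFn w)).map fun T => T.eval (primFields ρ u ϑ t) PIdx.rho PIdx.theta y).sum ^ 2) +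
          (∑ k, Real.sqrt (∫ y, iterPartialDeriv (List.ofFn w) (fun y => u t y k) y ^ 2) *
            Real.sqrt (∫ y, ((GG ζ k (List.ofFn w)).map fun T => T.eval (primFields ρ u ϑ t) PIdx.rho PIdx.theta y).sum ^ 2)) +
          Real.sqrt (∫ y, iterPartialDeriv (List.ofFn w) (ϑ t) y ^ 2) *
            Real.sqrt (∫ y, ((HH ζ (List.ofFn w)).map fun T => T.eval (primFields ρ u ϑ t) PIdx.rho PIdx.theta y).sum ^ 2)) := by
        rw [← hLdef] at key
        exact key
      have e1 : 2 * L * (5 * (X * Q)) = 10 * L * (X * Q) := by ring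
      have e2 : 10 * L * Γ * S ^ (m + 1) * ((4 + Bc * Real.sqrt KS) * E + 1) =
          10 * L * (Γ * S ^ (m + 1) * ((4 + Bc * Real.sqrt KS) * E + 1)) := by ring
      calc |D (List.ofFn w) t| ≤ (L + 18 * L ^ 2) * wordEnergy ρ u ϑ (List.ofFn w) t + 2 * L * (5 * (X * Q)) :=
            key'.trans (add_le_add le_rfl (mul_le_mul_of_nonneg_left hsrc (mul_nonneg zero_le_two hL0)))
        _ ≤ (L + 18 * L ^ 2) * wordEnergy ρ u ϑ (List.ofFn w) t + κ * ((4 + Bc * Real.sqrt KS) * E + 1) := by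
            rw [hκ, e1, e2]
            exact add_le_add le_rfl (mul_le_mul_of_nonneg_left hXQ' (mul_nonneg (by norm_num : (0 : ℝ) ≤ 10) hL0))
    -- sum over the words
    have hsumD : |g' t| ≤ (L + 18 * L ^ 2) * E + κ * ((4 + Bc * Real.sqrt KS) * E + 1) * (levelCount m) := by
      show |∑ n ∈ Finset.range (m + 1), ∑ w : Fin n → Fin 3, D (List.ofFn w) t| ≤ _
      calc |∑ n ∈ Finset.range (m + 1), ∑ w : Fin n → Fin 3, D (List.ofFn w) t|
          ≤ ∑ n ∈ Finset.range (m + 1), ∑ w : Fin n → Fin 3, |D (List.ofFn w) t| :=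
            (Finset.abs_sum_le_sum_abs _ _).trans (Finset.sum_le_sum fun n _ => Finset.abs_sum_le_sum_abs _ _)
        _ ≤ ∑ n ∈ Finset.range (m + 1), ∑ w : Fin n → Fin 3,
            ((L + 18 * L ^ 2) * wordEnergy ρ u ϑ (List.ofFn w) t + κ * ((4 + Bc * Real.sqrt KS) * E + 1)) :=
            Finset.sum_le_sum fun n hn => Finset.sum_le_sum fun w _ =>
              hword n w (Nat.lt_succ_iff.1 (Finset.mem_range.1 hn))
        _ = ∑ n ∈ Finset.range (m + 1), ((L + 18 * L ^ 2) * (∑ w : Fin n → Fin 3, wordEnergy ρ u ϑ (List.ofFn w) t) +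
            κ * ((4 + Bc * Real.sqrt KS) * E + 1) * ((Finset.univ : Finset (Fin n → Fin 3)).card : ℝ)) := by
            refine Finset.sum_congr rfl fun n _ => ?_
            rw [Finset.sum_add_distrib, Finset.sum_const, nsmul_eq_mul, ← Finset.mul_sum,
              mul_comm ((Finset.univ : Finset (Fin n → Fin 3)).card : ℝ)]
        _ = (L + 18 * L ^ 2) * E + κ * ((4 + Bc * Real.sqrt KS) * E + 1) * (levelCount m) := by
            rw [Finset.sum_add_distrib, ← Finset.mul_sum, ← Finset.mul_sum]
            simp only [hEdef, levelEnergy, levelCount]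
    have hEg : E ≤ g t / c₀ := by rw [le_div_iff₀ hc₀, mul_comm, hEdef]; exact (hcmp t htc).1
    rw [Real.norm_eq_abs, Real.norm_eq_abs, abs_of_nonneg (hgnn t htc)]
    calc |g' t| ≤ (L + 18 * L ^ 2) * E + κ * ((4 + Bc * Real.sqrt KS) * E + 1) * (levelCount m) := hsumD
      _ ≤ K₁ * (levelCount m) * E + εc := by
          rw [hK₁, hεc]
          have key : (L + 18 * L ^ 2) * E ≤ (L + 18 * L ^ 2) * E * levelCount m :=
            le_mul_of_one_le_right (mul_nonneg hL18 hE0) hW1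
          calc (L + 18 * L ^ 2) * E + κ * ((4 + Bc * Real.sqrt KS) * E + 1) * levelCount m
              = (L + 18 * L ^ 2) * E + (κ * (4 + Bc * Real.sqrt KS) * levelCount m * E + κ * levelCount m) := by
                ring
            _ ≤ (L + 18 * L ^ 2) * E * levelCount m +
                (κ * (4 + Bc * Real.sqrt KS) * levelCount m * E + κ * levelCount m) := add_le_add key le_rfl
            _ = ((L + 18 * L ^ 2) + κ * (4 + Bc * Real.sqrt KS)) * levelCount m * E + κ * levelCount m := by
                ring
      _ ≤ Kc * g t + εc := by
          rw [hKcdef]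
          have hg0 := hgnn t htc
          have h1 : K₁ * (levelCount m) * E ≤ K₁ * (levelCount m) * (g t / c₀) :=
            mul_le_mul_of_nonneg_left hEg (mul_nonneg hK₁0 hW0)
          have h2 : K₁ * (levelCount m) * (g t / c₀) = K₁ * (levelCount m) / c₀ * g t := by ring
          rw [add_mul, one_mul, ← h2]
          exact add_le_add (h1.trans (le_add_of_nonneg_right hg0)) le_rfl
  -- (9) Grönwall on `[0, τ]` and the conclusion at `t₀`
  have h0τ : (0 : ℝ) ∈ Icc 0 τ := ⟨le_rfl, hτ.le⟩
  have hg0δ : ‖g 0‖ ≤ δ := by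
    rw [Real.norm_eq_abs, abs_of_nonneg (hgnn 0 h0τ), hδdef]; exact (hcmp 0 h0τ).2
  have hgron := norm_le_gronwallBound_of_norm_deriv_right_le hcont hderiv' hg0δ hbound t₀ ht₀τ
  simp only [gronwallBound_of_K_ne_0 hKc.ne', Real.norm_eq_abs, abs_of_nonneg (hgnn t₀ ht₀τ),
    sub_zero] at hgron
  rw [le_div_iff₀ hc₀, mul_comm, ← hδdef]
  exact ((hcmp t₀ ht₀τ).1).trans hgron

/-- **The induction step of the `H^m` estimate, with constants UNIFORM in the solution** (Majda
1984, proof of Thm 2.2, eq. (2.38), in the quantitative form needed for a lower bound on the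
life span): for every compact set `K` of the hyperbolicity region, every `C¹` bound `M`, every
bound `Cprev` of the level-`(m-1)` energy and every level `m ≥ 2` there are constants
`c₀, c₁, K_c > 0`, `ε_c ≥ 0` such that EVERY primitive solution on `[0, T)` with state in `K`,
`C¹` size `≤ M` and level-`(m-1)` energy `≤ Cprev` satisfies, for all `t ∈ [0, T)`,
`E_m(t) ≤ (c₁ E_m(0) e^{K_c t} + (ε_c/K_c)(e^{K_c t} − 1)) / c₀` (same proof as
`levelEnergy_step`, constants built before the solution is introduced).
[cite: Majda1984, Ch. 2 §2.1 Thm 2.1 ("T depends on ‖u₀‖_s and G₁"), Thm 2.2 (2.38)] -/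
theorem levelEnergy_step_uniform (hζ : ContDiff ℝ ∞ ζ) {K : Set (ℝ × ℝ)} (hK : IsCompact K)
    (hKhyp : K ⊆ {z : ℝ × ℝ | 0 < z.1 ∧ 0 < z.2 ∧ 0 < deriv (fun s => s * ζ s) z.1})
    (M Cprev : ℝ) {m : ℕ} (hm : 2 ≤ m) :
    ∃ c₀ c₁ Kc εc : ℝ, 0 < c₀ ∧ 0 < c₁ ∧ 0 < Kc ∧ 0 ≤ εc ∧
      ∀ {T : ℝ}, 0 < T → ∀ {ρ ϑ : ℝ → (UnitAddTorus (Fin 3)) → ℝ} {u : ℝ → (UnitAddTorus (Fin 3)) → (EuclideanSpace ℝ (Fin 3))},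
        IsPrimitiveEulerSolutionOn (EulerEOS.monatomicExcess ζ f) (Ico 0 T) ρ u ϑ →
        (∀ t ∈ Ico 0 T, ∀ x, (ρ t x, ϑ t x) ∈ K) →
        (∀ t ∈ Ico 0 T, ∀ x, ‖u t x‖ ≤ M ∧ ∀ i, |partialDeriv i (ρ t) x| ≤ M ∧
          ‖partialDeriv i (u t) x‖ ≤ M ∧ |partialDeriv i (ϑ t) x| ≤ M) →
        (∀ t ∈ Ico 0 T, levelEnergy ρ u ϑ (m - 1) t ≤ Cprev) →
        ∀ t₀ ∈ Ico 0 T, levelEnergy ρ u ϑ m t₀ ≤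
          (c₁ * levelEnergy ρ u ϑ m 0 * Real.exp (Kc * t₀) + εc / Kc * (Real.exp (Kc * t₀) - 1)) / c₀ := by
  obtain ⟨c₀, c₁, hc₀, hc₀₁, hwK⟩ := exists_weights_bounds hζ hK hKhyp
  obtain ⟨Kc, εc, hKc, hεc, h⟩ := levelEnergy_step_of_weights (f := f) hζ hK hKhyp hc₀ hc₀₁ hwK M Cprev hm
  exact ⟨c₀, c₁, Kc, εc, hc₀, hc₀.trans_le hc₀₁, hKc, hεc, h⟩

/-! ### Levels one to three -/

/-- **Bound of the level-`3` energy with prescribed weight bounds**: given the two-sided weight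
bounds `c₀ ≤ A, ρ, C ≤ c₁` on `K`, for every `C¹` bound `M` and data size `E₀` there are `κ > 0`,
`β ≥ 0` such that every primitive solution on `[0, T)`, `T ≤ 1`, with state in `K`, `C¹` size
`≤ M` and `E₃(0) ≤ E₀` satisfies `E₃(t) ≤ (c₁/c₀) E₃(0) e^{κt} + β (e^{κt} − 1)` for all `t ∈ [0, T)`
(levels `0, 1` from the `C¹` bound, levels `2, 3` by `levelEnergy_step_of_weights`).
[cite: Majda1984, Ch. 2 §2.1 Thm 2.1, Thm 2.2 (2.38)] -/
theorem levelEnergy_three_of_weights (hζ : ContDiff ℝ ∞ ζ) {K : Set (ℝ × ℝ)} (hK : IsCompact K)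
    (hKhyp : K ⊆ {z : ℝ × ℝ | 0 < z.1 ∧ 0 < z.2 ∧ 0 < deriv (fun s => s * ζ s) z.1})
    {c₀ c₁ : ℝ} (hc₀ : 0 < c₀) (hc₀₁ : c₀ ≤ c₁)
    (hwK : ∀ z ∈ K, (c₀ ≤ Acoef ζ z.1 z.2 ∧ Acoef ζ z.1 z.2 ≤ c₁) ∧ (c₀ ≤ z.1 ∧ z.1 ≤ c₁) ∧
      (c₀ ≤ Ccoef z.1 z.2 ∧ Ccoef z.1 z.2 ≤ c₁))
    (M E₀ : ℝ) :
    ∃ κ β : ℝ, 0 < κ ∧ 0 ≤ β ∧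
      ∀ {T : ℝ}, 0 < T → T ≤ 1 → ∀ {ρ ϑ : ℝ → (UnitAddTorus (Fin 3)) → ℝ} {u : ℝ → (UnitAddTorus (Fin 3)) → (EuclideanSpace ℝ (Fin 3))},
        IsPrimitiveEulerSolutionOn (EulerEOS.monatomicExcess ζ f) (Ico 0 T) ρ u ϑ →
        (∀ t ∈ Ico 0 T, ∀ x, (ρ t x, ϑ t x) ∈ K) →
        (∀ t ∈ Ico 0 T, ∀ x, ‖u t x‖ ≤ M ∧ ∀ i, |partialDeriv i (ρ t) x| ≤ M ∧
          ‖partialDeriv i (u t) x‖ ≤ M ∧ |partialDeriv i (ϑ t) x| ≤ M) →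
        levelEnergy ρ u ϑ 3 0 ≤ E₀ →
        ∀ t ∈ Ico 0 T, levelEnergy ρ u ϑ 3 t ≤
          c₁ / c₀ * levelEnergy ρ u ϑ 3 0 * Real.exp (κ * t) + β * (Real.exp (κ * t) - 1) := by
  have hc₁ : 0 < c₁ := hc₀.trans_le hc₀₁
  -- the `C¹`/state bound `Λ` for levels `0, 1`
  obtain ⟨B1, -, b1⟩ := exists_abs_le_of_continuousOn hK continuous_fst.continuousOn
  obtain ⟨B2, -, b2⟩ := exists_abs_le_of_continuousOn hK continuous_snd.continuousOn
  obtain ⟨Λ, hΛ⟩ : ∃ Λ : ℝ, Λ = |B1| + |B2| + |M| := ⟨_, rfl⟩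
  -- level 2 from `Cprev₁ = 20 Λ²`, level 3 from the resulting bound on `[0, 1]`
  obtain ⟨K₂, ε₂, hK₂, hε₂, hstep₂⟩ :=
    levelEnergy_step_of_weights (f := f) hζ hK hKhyp hc₀ hc₀₁ hwK M (20 * Λ ^ 2) (m := 2) le_rfl
  obtain ⟨Cprev₂, hCprev₂⟩ : ∃ C : ℝ, C = (c₁ * |E₀| * Real.exp K₂ + ε₂ / K₂ * (Real.exp K₂ - 1)) / c₀ :=
    ⟨_, rfl⟩
  obtain ⟨K₃, ε₃, hK₃, hε₃, hstep₃⟩ :=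
    levelEnergy_step_of_weights (f := f) hζ hK hKhyp hc₀ hc₀₁ hwK M Cprev₂ (m := 3) (by norm_num)
  refine ⟨K₃, ε₃ / K₃ / c₀, hK₃, by positivity, ?_⟩
  intro T hT hT1 ρ ϑ u h hstate hC1 hE₀ t ht
  -- levels `0, 1`
  have hlow : ∀ t ∈ Ico 0 T, ∀ (k : PIdx) (v : List (Fin 3)), v.length ≤ 1 → ∀ x,
      |iterPartialDeriv v (primFields ρ u ϑ t k) x| ≤ Λ := by
    intro t ht k v hv x
    have hu1 : IsContDiff 1 (u t) := (h.smooth_velocity.isSmooth_slice ht).isContDiff (by simp)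
    have hz := hstate t ht x
    have hM : M ≤ Λ := by rw [hΛ]; linarith [le_abs_self M, abs_nonneg B1, abs_nonneg B2]
    rcases list_length_le_one hv with rfl | ⟨i, rfl⟩
    · rcases k with _ | _ | k
      · show |ρ t x| ≤ Λ
        have : |(ρ t x, ϑ t x).1| ≤ B1 := b1 _ hz
        simp only at this; rw [hΛ]; linarith [abs_nonneg M, le_abs_self B1, abs_nonneg B2]
      · show |ϑ t x| ≤ Λ
        have : |(ρ t x, ϑ t x).2| ≤ B2 := b2 _ hz
        simp only at this; rw [hΛ]; linarith [abs_nonneg M, le_abs_self B2, abs_nonneg B1]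
      · simp only [iterPartialDeriv_nil, primFields]
        exact ((abs_apply_le_norm _ _).trans (hC1 t ht x).1).trans hM
    · rcases k with _ | _ | k
      · simpa using (((hC1 t ht x).2 i).1).trans hM
      · simpa using (((hC1 t ht x).2 i).2.2).trans hM
      · simp only [iterPartialDeriv_cons, iterPartialDeriv_nil, primFields]
        rw [partialDeriv_apply_coord hu1]
        exact ((abs_apply_le_norm _ _).trans ((hC1 t ht x).2 i).2.1).trans hM
  have h1 := levelEnergy_one_le h hlow
  -- level `2` on `[0, T)`, `T ≤ 1`
  have hE3_0 : 0 ≤ levelEnergy ρ u ϑ 3 0 := levelEnergy_nonneg _ _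
  have h2 : ∀ s ∈ Ico 0 T, levelEnergy ρ u ϑ 2 s ≤ Cprev₂ := by
    intro s hs
    have hb := hstep₂ hT h hstate hC1 (fun s hs => by simpa using h1 s hs) s hs
    refine hb.trans ?_
    rw [hCprev₂]
    refine div_le_div_of_nonneg_right ?_ hc₀.le
    have hexp : Real.exp (K₂ * s) ≤ Real.exp K₂ := by
      apply Real.exp_le_exp.2
      have : s ≤ 1 := hs.2.le.trans hT1
      nlinarith [hK₂.le, hs.1]
    have hexp1 : 1 ≤ Real.exp (K₂ * s) := Real.one_le_exp (mul_nonneg hK₂.le hs.1)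
    have hE20 : levelEnergy ρ u ϑ 2 0 ≤ |E₀| :=
      ((levelEnergy_mono (by norm_num : 2 ≤ 3) 0).trans hE₀).trans (le_abs_self _)
    have hE2nn : 0 ≤ levelEnergy ρ u ϑ 2 0 := levelEnergy_nonneg _ _
    have hεK : 0 ≤ ε₂ / K₂ := div_nonneg hε₂ hK₂.le
    have t1 : c₁ * levelEnergy ρ u ϑ 2 0 * Real.exp (K₂ * s) ≤ c₁ * |E₀| * Real.exp K₂ :=
      mul_le_mul (mul_le_mul_of_nonneg_left hE20 hc₁.le) hexp (Real.exp_pos _).le (by positivity)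
    have t2 : ε₂ / K₂ * (Real.exp (K₂ * s) - 1) ≤ ε₂ / K₂ * (Real.exp K₂ - 1) :=
      mul_le_mul_of_nonneg_left (by linarith) hεK
    linarith
  -- level `3`
  have hb := hstep₃ hT h hstate hC1 h2 t ht
  refine hb.trans (le_of_eq ?_)
  field_simp

/-- **Uniform bound of the level-`3` energy.** For every compact set `K` of the hyperbolicity
region, `C¹` bound `M` and data size `E₀` there are `κ > 0`, `A, β ≥ 0` such that every primitive
solution on `[0, T)`, `T ≤ 1`, with state in `K`, `C¹` size `≤ M` and `E₃(0) ≤ E₀` satisfies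
`E₃(t) ≤ A E₃(0) e^{κt} + β (e^{κt} − 1)` for all `t ∈ [0, T)` (levels `0, 1` from the `C¹` bound,
levels `2, 3` by `levelEnergy_step_uniform`). [cite: Majda1984, Ch. 2 §2.1 Thm 2.1, Thm 2.2 (2.38)] -/
theorem levelEnergy_three_uniform (hζ : ContDiff ℝ ∞ ζ) {K : Set (ℝ × ℝ)} (hK : IsCompact K)
    (hKhyp : K ⊆ {z : ℝ × ℝ | 0 < z.1 ∧ 0 < z.2 ∧ 0 < deriv (fun s => s * ζ s) z.1})
    (M E₀ : ℝ) :
    ∃ κ A β : ℝ, 0 < κ ∧ 0 ≤ A ∧ 0 ≤ β ∧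
      ∀ {T : ℝ}, 0 < T → T ≤ 1 → ∀ {ρ ϑ : ℝ → (UnitAddTorus (Fin 3)) → ℝ} {u : ℝ → (UnitAddTorus (Fin 3)) → (EuclideanSpace ℝ (Fin 3))},
        IsPrimitiveEulerSolutionOn (EulerEOS.monatomicExcess ζ f) (Ico 0 T) ρ u ϑ →
        (∀ t ∈ Ico 0 T, ∀ x, (ρ t x, ϑ t x) ∈ K) →
        (∀ t ∈ Ico 0 T, ∀ x, ‖u t x‖ ≤ M ∧ ∀ i, |partialDeriv i (ρ t) x| ≤ M ∧
          ‖partialDeriv i (u t) x‖ ≤ M ∧ |partialDeriv i (ϑ t) x| ≤ M) →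
        levelEnergy ρ u ϑ 3 0 ≤ E₀ →
        ∀ t ∈ Ico 0 T, levelEnergy ρ u ϑ 3 t ≤
          A * levelEnergy ρ u ϑ 3 0 * Real.exp (κ * t) + β * (Real.exp (κ * t) - 1) := by
  obtain ⟨c₀, c₁, hc₀, hc₀₁, hwK⟩ := exists_weights_bounds hζ hK hKhyp
  obtain ⟨κ, β, hκ, hβ, h⟩ := levelEnergy_three_of_weights (f := f) hζ hK hKhyp hc₀ hc₀₁ hwK M E₀
  exact ⟨κ, c₁ / c₀, β, hκ, div_nonneg (hc₀.le.trans hc₀₁) hc₀.le, hβ, h⟩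

/-! ### The `C¹` size from the level-`3` energy -/

/-- **Sobolev read-out.** With the absolute constant `K_S` of `exists_sobolev_const`: at every time
at which the five primitive fields are smooth, `‖u‖, |∂ᵢρ|, ‖∂ᵢu‖, |∂ᵢϑ| ≤ 3 √(K_S E₃)`.
[cite: Majda1984, Ch. 2 §2.1 Thm 2.2 (Sobolev's lemma in the continuation principle)] -/
theorem exists_C1_le_sqrt_levelEnergy_three :
    ∃ KS : ℝ, 0 < KS ∧ ∀ (ρ ϑ : ℝ → (UnitAddTorus (Fin 3)) → ℝ) (u : ℝ → (UnitAddTorus (Fin 3)) → (EuclideanSpace ℝ (Fin 3))) (t : ℝ),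
      (∀ k, IsSmooth (primFields ρ u ϑ t k)) → IsSmooth (u t) →
      ∀ x, ‖u t x‖ ≤ 3 * Real.sqrt (KS * levelEnergy ρ u ϑ 3 t) ∧
        ∀ i, |partialDeriv i (ρ t) x| ≤ 3 * Real.sqrt (KS * levelEnergy ρ u ϑ 3 t) ∧
          ‖partialDeriv i (u t) x‖ ≤ 3 * Real.sqrt (KS * levelEnergy ρ u ϑ 3 t) ∧
          |partialDeriv i (ϑ t) x| ≤ 3 * Real.sqrt (KS * levelEnergy ρ u ϑ 3 t) := by
  obtain ⟨KS, hKS, hSob⟩ := exists_sobolev_const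
  refine ⟨KS, hKS, fun ρ ϑ u t hφ hu x => ?_⟩
  set E := levelEnergy ρ u ϑ 3 t with hE
  have hE0 : 0 ≤ E := levelEnergy_nonneg _ _
  -- every word of length `≤ 1` of every field is `≤ √(KS E)`
  have hk : ∀ (k : PIdx) (v : List (Fin 3)), v.length ≤ 1 →
      |iterPartialDeriv v (primFields ρ u ϑ t k) x| ≤ Real.sqrt (KS * E) := by
    intro k v hv
    have h2 := hSob ρ ϑ u t hφ k v x
    have h3 : levelEnergy ρ u ϑ (v.length + 2) t ≤ E := levelEnergy_mono (by omega) t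
    calc |iterPartialDeriv v (primFields ρ u ϑ t k) x|
        = Real.sqrt (iterPartialDeriv v (primFields ρ u ϑ t k) x ^ 2) := (Real.sqrt_sq_eq_abs _).symm
      _ ≤ Real.sqrt (KS * E) := Real.sqrt_le_sqrt (h2.trans (mul_le_mul_of_nonneg_left h3 hKS.le))
  have hs0 : 0 ≤ Real.sqrt (KS * E) := Real.sqrt_nonneg _
  have hu1 : IsContDiff 1 (u t) := hu.isContDiff (by simp)
  refine ⟨?_, fun i => ⟨?_, ?_, ?_⟩⟩
  · calc ‖u t x‖ ≤ ∑ k, |u t x k| := norm_le_sum_abs _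
      _ ≤ ∑ _k : Fin 3, Real.sqrt (KS * E) := Finset.sum_le_sum fun k _ => by
          simpa [primFields] using hk (PIdx.vel k) [] (by simp)
      _ = 3 * Real.sqrt (KS * E) := by simp
  · have := hk PIdx.rho [i] (by simp)
    simpa [primFields] using this.trans (by linarith : Real.sqrt (KS * E) ≤ 3 * Real.sqrt (KS * E))
  · calc ‖partialDeriv i (u t) x‖ ≤ ∑ k, |partialDeriv i (u t) x k| := norm_le_sum_abs _
      _ = ∑ k, |partialDeriv i (fun y => u t y k) x| := by
          refine Finset.sum_congr rfl fun k _ => ?_; rw [partialDeriv_apply_coord hu1]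
      _ ≤ ∑ _k : Fin 3, Real.sqrt (KS * E) := Finset.sum_le_sum fun k _ => by
          simpa [primFields] using hk (PIdx.vel k) [i] (by simp)
      _ = 3 * Real.sqrt (KS * E) := by simp
  · have := hk PIdx.theta [i] (by simp)
    simpa [primFields] using this.trans (by linarith : Real.sqrt (KS * E) ≤ 3 * Real.sqrt (KS * E))

end CompressibleEuler

end Literature.Analysis.FluidPDE

end
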